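import Summits.NavierStokesRegularity.NavierStokesRegularity.Theorems.OddMorawetzOddMorawetzLocalNormFSemanticsSort
import Summits.NavierStokesRegularity.NavierStokesRegularity.Theorems.OddMorawetzOddMorawetzLocalCoeffSemantics
import Summits.NavierStokesRegularity.NavierStokesRegularity.Theorems.OddMorawetzOddMorawetzLocalEvalA
import HarnessLib

/-!
# The merge-sort normal form `JPoly.normF`, II: values, coefficients, canonicity (stub `normF_semantics`)

Crux `OddMorawetzLocal` (item stmt-NavierStokesRegularity-1376), refutation skeleton (lead c1), registered stub
`normF_semantics`.  Pure list algebra over Mathlib on the computable jet polynomials `JPoly R = List (R × List JVar)`;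
no named facts, no new definitions.  Builds on the list combinatorics of `…NormFSemanticsSort` (`msort_perm`,
`msort_sorted`, `mergeCollect_pairwise_lt`, `snd_mem_mergeCollect`, `normF_map`, `monoCmp_self`) and reuses the
landed `evalA_cons` (`…NormCast`), `evalA_map_sortVars` (`…EvalA`), `CoeffSemantics.coeffOf_cons'`
(`…CoeffSemantics`) and `sortVars_sortVars` (`…IdxCompleteSort`).

The kernel certificates of the refutation (`derKillsF`, `orbitReconF`, `nfKillsF`, `isoPolyF`, `isoCertCheck`)
normalise integer jet polynomials with the merge-sort normal form `JPoly.normF` (the insertion normal form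
`JPoly.norm` is quadratic and too slow in the kernel).  To turn `normF q = []` or `normF q = normF q'` into
statements about densities and coefficient vectors the assembly needs exactly:

1. `evalA_normF` — `normF` preserves the value `evalA p ζ` of a real polynomial (permutations preserve a sum,
   merging `(c, m), (c', m)` into `(c + c', m)` preserves it, zero terms contribute zero, `evalA_map_sortVars`);
2. `cast_normF` — the coefficient cast `ℚ → ℝ` commutes with `normF` (`normF_map` for `Rat.cast`);
3. `evalA_normF_intCast` — the real value of an integer polynomial is that of its normal form (`normF_map` for
   `Int.cast`, then 1);
4. `coeffOf_normF` — `normF` preserves every coefficient sum `coeffOf p m` of a polynomial with sorted monomials;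
5. `normF_canonical` — the output terms have `sortVars`-fixed monomials (`sortVars_sortVars`) and non-zero
   coefficients (the filter);
6. `normF_pairwise_ne` — the output monomials are pairwise distinct (merge sort sorts, collecting a sorted list gives
   strictly increasing monomials, the filter keeps a sublist);

assembled in `normF_semantics` (the registered signature).
-/

noncomputable section

set_option linter.dupNamespace false
set_option autoImplicit false

namespace Summit.NavierStokesRegularity.NavierStokesRegularity.Theorems.OddMorawetz

open CoeffSemantics

namespace JPoly

/-! ### Values: `evalA` through permutations, collecting and the zero filter -/

/-- Permuting the terms does not change the value. -/
theorem evalA_perm {p q : JPoly ℝ} (h : p.Perm q) (ζ : JVar → ℝ) : evalA p ζ = evalA q ζ :=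
  (h.map _).sum_eq

/-- Collecting equal adjacent monomials does not change the value. -/
theorem evalA_collectAcc (ζ : JVar → ℝ) : ∀ (cur : ℝ × List JVar) (rest : JPoly ℝ),
    evalA (collectAcc cur rest) ζ = evalA (cur :: rest) ζ
  | cur, [] => rfl
  | cur, u :: rest => by
    simp only [collectAcc]
    split_ifs with h
    · rw [evalA_collectAcc ζ _ rest, evalA_cons, evalA_cons, evalA_cons, h]; ring
    · rw [evalA_cons, evalA_collectAcc ζ u rest, evalA_cons cur (u :: rest)]

/-- `mergeCollect` does not change the value. -/
theorem evalA_mergeCollect (q : JPoly ℝ) (ζ : JVar → ℝ) : evalA (mergeCollect q) ζ = evalA q ζ := by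
  cases q with
  | nil => rfl
  | cons u rest => exact evalA_collectAcc ζ u rest

/-- Dropping terms with coefficient `0` does not change the value. -/
theorem evalA_filter (P : ℝ × List JVar → Bool) (hP : ∀ t, P t = false → t.1 = 0) (q : JPoly ℝ) (ζ : JVar → ℝ) :
    evalA (q.filter P) ζ = evalA q ζ := by
  induction q with
  | nil => rfl
  | cons t q ih =>
    rw [List.filter_cons]
    split_ifs with h
    · rw [evalA_cons, evalA_cons, ih]
    · rw [evalA_cons, ih, hP t (by simpa using h), zero_mul, zero_add]

/-- **Part 1: the fast normal form preserves the value.** -/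
theorem evalA_normF (p : JPoly ℝ) (ζ : JVar → ℝ) : evalA (normF p) ζ = evalA p ζ := by
  unfold normF
  rw [evalA_filter _ (fun t ht => by simpa using ht), evalA_mergeCollect, evalA_perm (msort_perm _ _),
    evalA_map_sortVars]

/-- **Part 2: the coefficient cast `ℚ → ℝ` commutes with the fast normal form.** -/
theorem cast_normF (p : JPoly ℚ) : cast (normF p) = normF (cast p) :=
  (normF_map (fun c : ℚ => (c : ℝ)) Rat.cast_add (fun _ => Rat.cast_eq_zero) p).symm

/-- **Part 3: the fast normal form of an integer polynomial has the same real value.** -/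
theorem evalA_normF_intCast (p : JPoly ℤ) (ζ : JVar → ℝ) :
    evalA ((normF p).map fun t => ((t.1 : ℝ), t.2)) ζ = evalA (p.map fun t => ((t.1 : ℝ), t.2)) ζ := by
  rw [← normF_map (fun c : ℤ => (c : ℝ)) Int.cast_add (fun _ => Int.cast_eq_zero) p, evalA_normF]

/-! ### Coefficients: `coeffOf` through permutations, collecting and the zero filter -/

/-- Permuting the terms does not change any coefficient. -/
theorem coeffOf_perm {R : Type} [CommRing R] {p q : JPoly R} (h : p.Perm q) (m : List JVar) :
    coeffOf p m = coeffOf q m :=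
  ((h.filter _).map _).sum_eq

/-- Collecting equal adjacent monomials does not change any coefficient. -/
theorem coeffOf_collectAcc {R : Type} [CommRing R] (m : List JVar) : ∀ (cur : R × List JVar) (rest : JPoly R),
    coeffOf (collectAcc cur rest) m = coeffOf (cur :: rest) m
  | cur, [] => rfl
  | cur, u :: rest => by
    simp only [collectAcc]
    split_ifs with h
    · rw [coeffOf_collectAcc m _ rest, coeffOf_cons', coeffOf_cons', coeffOf_cons', ← h]
      dsimp only
      split_ifs <;> ring
    · rw [coeffOf_cons', coeffOf_collectAcc m u rest, coeffOf_cons' cur (u :: rest)]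

/-- `mergeCollect` does not change any coefficient. -/
theorem coeffOf_mergeCollect {R : Type} [CommRing R] (q : JPoly R) (m : List JVar) :
    coeffOf (mergeCollect q) m = coeffOf q m := by
  cases q with
  | nil => rfl
  | cons u rest => exact coeffOf_collectAcc m u rest

/-- Dropping terms with coefficient `0` does not change any coefficient. -/
theorem coeffOf_filter {R : Type} [CommRing R] (P : R × List JVar → Bool) (hP : ∀ t, P t = false → t.1 = 0)
    (q : JPoly R) (m : List JVar) : coeffOf (q.filter P) m = coeffOf q m := by
  induction q with
  | nil => rfl
  | cons t q ih =>
    rw [List.filter_cons]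
    split_ifs with h
    · rw [coeffOf_cons', coeffOf_cons', ih]
    · rw [coeffOf_cons', ih, hP t (by simpa using h)]
      simp

/-- **Part 4: the fast normal form preserves the coefficients** of a polynomial with sorted monomials. -/
theorem coeffOf_normF {R : Type} [CommRing R] [DecidableEq R] (p : JPoly R) (hp : ∀ t ∈ p, sortVars t.2 = t.2)
    (m : List JVar) : coeffOf (normF p) m = coeffOf p m := by
  have hmap : (p.map fun t => (t.1, sortVars t.2)) = p := by
    conv_rhs => rw [← List.map_id p]
    exact List.map_congr_left fun t ht => by rw [hp t ht]; rfl
  unfold normF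
  rw [coeffOf_filter _ (fun t ht => by simpa using ht), coeffOf_mergeCollect, coeffOf_perm (msort_perm _ _), hmap]

/-! ### Canonicity -/

/-- **Part 5: the terms of the fast normal form have sorted monomials and non-zero coefficients.** -/
theorem normF_canonical {R : Type} [Add R] [Zero R] [DecidableEq R] (p : JPoly R) :
    ∀ t ∈ normF p, sortVars t.2 = t.2 ∧ t.1 ≠ 0 := by
  intro t ht
  unfold normF at ht
  rw [List.mem_filter] at ht
  refine ⟨?_, by simpa using ht.2⟩
  obtain ⟨s, hs, hts⟩ := snd_mem_mergeCollect ht.1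
  rw [(msort_perm _ _).mem_iff, List.mem_map] at hs
  obtain ⟨u, -, rfl⟩ := hs
  rw [hts]
  exact sortVars_sortVars u.2

/-- **Part 6: the monomials of the fast normal form are pairwise distinct** (merge sort sorts, collecting a sorted
list gives strictly increasing monomials, the filter keeps a sublist). -/
theorem normF_pairwise_ne {R : Type} [Add R] [Zero R] [DecidableEq R] (p : JPoly R) :
    (normF p).Pairwise fun s t => s.2 ≠ t.2 := by
  unfold normF
  refine List.Pairwise.filter _ ((mergeCollect_pairwise_lt (msort_sorted _ _ (by simp))).imp ?_)
  intro s t h hst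
  rw [hst, monoCmp_self] at h
  exact absurd h (by decide)

end JPoly

/-! ### The registered stub -/

/-- **Stub `normF_semantics` of crux `OddMorawetzLocal` (refutation).**  The merge-sort normal form `JPoly.normF`
preserves the value of a real jet polynomial, commutes with the coefficient cast `ℚ → ℝ`, preserves the real value
of an integer polynomial, preserves the coefficients of a polynomial with sorted monomials, and returns terms with
sorted monomials, non-zero coefficients and pairwise distinct monomials. -/
theorem normF_semantics :
    (∀ (p : JPoly ℝ) (ζ : JVar → ℝ), JPoly.evalA (JPoly.normF p) ζ = JPoly.evalA p ζ) ∧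
    (∀ (p : JPoly ℚ), JPoly.cast (JPoly.normF p) = JPoly.normF (JPoly.cast p)) ∧
    (∀ (p : JPoly ℤ) (ζ : JVar → ℝ),
      JPoly.evalA ((JPoly.normF p).map fun t => ((t.1 : ℝ), t.2)) ζ = JPoly.evalA (p.map fun t => ((t.1 : ℝ), t.2)) ζ) ∧
    (∀ {R : Type} [CommRing R] [DecidableEq R] (p : JPoly R), (∀ t ∈ p, sortVars t.2 = t.2) →
      ∀ m : List JVar, JPoly.coeffOf (JPoly.normF p) m = JPoly.coeffOf p m) ∧
    (∀ {R : Type} [CommRing R] [DecidableEq R] (p : JPoly R), ∀ t ∈ JPoly.normF p, sortVars t.2 = t.2 ∧ t.1 ≠ 0) ∧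
    (∀ {R : Type} [CommRing R] [DecidableEq R] (p : JPoly R), (JPoly.normF p).Pairwise fun s t => s.2 ≠ t.2) :=
  ⟨JPoly.evalA_normF, JPoly.cast_normF, JPoly.evalA_normF_intCast, JPoly.coeffOf_normF,
    fun p => JPoly.normF_canonical p, fun p => JPoly.normF_pairwise_ne p⟩

end Summit.NavierStokesRegularity.NavierStokesRegularity.Theorems.OddMorawetz

end
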